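import Literature.NumberTheory.Automorphic.QuadraticOrderPicardForms
import HarnessLib

/-!
# The units of an imaginary quadratic order: `#Bˣ = 6, 4, 2`

Topic `NumberTheory/Automorphic`; theorems only (no named fact, no `sorry`). Eleventh brick of
the Brandt-module side of the Eichler–Pizer trace identity: for an order `B = ℤ[σ]`
(`σ² = tσ - n`) of the imaginary quadratic field `ℚ(γ)` inside a division quaternion algebra,
the number of units of `B` is `6`, `4` or `2` according as `t² - 4n = -3`, `-4` or `< -4`
(the units are the `u + vσ` with `u² + tuv + nv² = 1`, i.e. `(2u + tv)² + |t² - 4n| v² = 4`).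

* `PicHyp.mem_units_iff` — `x ∈ B` is a unit of `B` iff `x = u + vσ` with `u² + tuv + nv² = 1`;
* `PicHyp.card_units_eq` — **`#Bˣ = if t² - 4n = -3 then 6 else if t² - 4n = -4 then 4 else 2`**.

## References

* D. A. Cox, *Primes of the form x² + ny²*, 2nd ed. (2013), §7.A (units of an order: Exercise
  7.14 / proof of Thm. 7.24: "𝒪* = {±1} unless …"), [Cox2013].
-/

noncomputable section

open scoped Pointwise
open Literature.NumberTheory.QuadraticFields.Quadratic

universe u

namespace Literature.NumberTheory.Automorphic

namespace Brandt

variable {D : Type u} [Ring D] [Algebra ℚ D] [IsQuaternionAlgebra ℚ D] {γ : D} {B : Submodule ℤ D}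


/-! ### The solutions of `u² + tuv + nv² = 1` -/

section Solutions

variable {t n : ℤ}

omit [IsQuaternionAlgebra ℚ D] [Algebra ℚ D] [Ring D] in
/-- Completing the square: `4(u² + tuv + nv²) = (2u + tv)² + (4n - t²) v²`. [folklore] -/
theorem four_mul_normForm (u v : ℤ) : 4 * (u ^ 2 + t * u * v + n * v ^ 2) = (2 * u + t * v) ^ 2 + (4 * n - t ^ 2) * v ^ 2 := by
  ring

omit [IsQuaternionAlgebra ℚ D] [Algebra ℚ D] [Ring D] in
/-- `u² = 1 ↔ u = 1 ∨ u = -1` over `ℤ`. [folklore] -/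
theorem int_sq_eq_one_iff (u : ℤ) : u ^ 2 = 1 ↔ u = 1 ∨ u = -1 := by
  constructor
  · intro h
    have : (u - 1) * (u + 1) = 0 := by linear_combination h
    rcases mul_eq_zero.mp this with h | h
    · left; linarith
    · right; linarith
  · rintro (rfl | rfl) <;> norm_num

omit [IsQuaternionAlgebra ℚ D] [Algebra ℚ D] [Ring D] in
/-- **The solutions of `u² + tuv + nv² = 1`** for `t² - 4n < -4`: `(±1, 0)`. [cite: Cox2013, §7.A (𝒪* = {±1})] -/
theorem solutions_of_lt {u v : ℤ} (hΔ : t ^ 2 - 4 * n < -4) :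
    u ^ 2 + t * u * v + n * v ^ 2 = 1 ↔ (u, v) ∈ ({(1, 0), (-1, 0)} : Finset (ℤ × ℤ)) := by
  simp only [Finset.mem_insert, Finset.mem_singleton, Prod.mk.injEq]
  constructor
  · intro h
    have h4 := four_mul_normForm (t := t) (n := n) u v
    rw [h, mul_one] at h4
    have hv : v = 0 := by
      by_contra hv
      have hv2 : 1 ≤ v ^ 2 := by
        have := sq_nonneg v
        have : v ^ 2 ≠ 0 := pow_ne_zero 2 hv
        omega
      nlinarith [sq_nonneg (2 * u + t * v)]
    subst hv
    have hu : u ^ 2 = 1 := by nlinarith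
    rcases (int_sq_eq_one_iff u).mp hu with rfl | rfl <;> simp
  · rintro (⟨rfl, rfl⟩ | ⟨rfl, rfl⟩) <;> ring

omit [IsQuaternionAlgebra ℚ D] [Algebra ℚ D] [Ring D] in
/-- **The solutions for `t² - 4n = -4`** (`t = 2k`, `n = k² + 1`): `(±1, 0)`, `(-k, 1)`, `(k, -1)`. [cite: Cox2013, §7.A (𝒪* for ℤ[i])] -/
theorem solutions_of_eq_neg_four {u v k : ℤ} (ht : t = 2 * k) (hΔ : t ^ 2 - 4 * n = -4) :
    u ^ 2 + t * u * v + n * v ^ 2 = 1 ↔ (u, v) ∈ ({(1, 0), (-1, 0), (-k, 1), (k, -1)} : Finset (ℤ × ℤ)) := by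
  have hn : n = k ^ 2 + 1 := by subst ht; nlinarith
  subst ht hn
  simp only [Finset.mem_insert, Finset.mem_singleton, Prod.mk.injEq]
  constructor
  · intro h
    have h4 : (u + k * v) ^ 2 + v ^ 2 = 1 := by nlinarith
    have hv2 : v ^ 2 ≤ 1 := by nlinarith [sq_nonneg (u + k * v)]
    have hv : v = 0 ∨ v = 1 ∨ v = -1 := by
      have : -1 ≤ v ∧ v ≤ 1 := by constructor <;> nlinarith
      omega
    rcases hv with rfl | rfl | rfl
    · have hu : u ^ 2 = 1 := by nlinarith
      rcases (int_sq_eq_one_iff u).mp hu with rfl | rfl <;> simp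
    · have : (u + k) ^ 2 = 0 := by nlinarith
      have hu : u = -k := by nlinarith [pow_eq_zero_iff (n := 2) (a := u + k) two_ne_zero |>.mp this]
      simp [hu]
    · have : (u - k) ^ 2 = 0 := by nlinarith
      have hu : u = k := by nlinarith [pow_eq_zero_iff (n := 2) (a := u - k) two_ne_zero |>.mp this]
      simp [hu]
  · rintro (⟨rfl, rfl⟩ | ⟨rfl, rfl⟩ | ⟨rfl, rfl⟩ | ⟨rfl, rfl⟩) <;> ring

omit [IsQuaternionAlgebra ℚ D] [Algebra ℚ D] [Ring D] in
/-- **The solutions for `t² - 4n = -3`** (`t = 2k + 1`, `n = k² + k + 1`): `(±1, 0)`, `(-k, 1)`,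
`(-k-1, 1)`, `(k+1, -1)`, `(k, -1)`. [cite: Cox2013, §7.A (𝒪* for ℤ[ω])] -/
theorem solutions_of_eq_neg_three {u v k : ℤ} (ht : t = 2 * k + 1) (hΔ : t ^ 2 - 4 * n = -3) :
    u ^ 2 + t * u * v + n * v ^ 2 = 1 ↔
      (u, v) ∈ ({(1, 0), (-1, 0), (-k, 1), (-k - 1, 1), (k + 1, -1), (k, -1)} : Finset (ℤ × ℤ)) := by
  have hn : n = k ^ 2 + k + 1 := by subst ht; nlinarith
  subst ht hn
  simp only [Finset.mem_insert, Finset.mem_singleton, Prod.mk.injEq]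
  constructor
  · intro h
    have h4 : (2 * u + (2 * k + 1) * v) ^ 2 + 3 * v ^ 2 = 4 := by nlinarith
    have hv : v = 0 ∨ v = 1 ∨ v = -1 := by
      have : -1 ≤ v ∧ v ≤ 1 := by constructor <;> nlinarith [sq_nonneg (2 * u + (2 * k + 1) * v)]
      omega
    rcases hv with rfl | rfl | rfl
    · have hu : u ^ 2 = 1 := by nlinarith
      rcases (int_sq_eq_one_iff u).mp hu with rfl | rfl <;> simp
    · have : (u + k) * (u + k + 1) = 0 := by nlinarith
      rcases mul_eq_zero.mp this with e | e
      · have hu : u = -k := by linarith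
        simp [hu]
      · have hu : u = -k - 1 := by linarith
        simp [hu]
    · have : (u - k) * (u - k - 1) = 0 := by nlinarith
      rcases mul_eq_zero.mp this with e | e
      · have hu : u = k := by linarith
        simp [hu]
      · have hu : u = k + 1 := by linarith
        simp [hu]
  · rintro (⟨rfl, rfl⟩ | ⟨rfl, rfl⟩ | ⟨rfl, rfl⟩ | ⟨rfl, rfl⟩ | ⟨rfl, rfl⟩ | ⟨rfl, rfl⟩) <;> ring

omit [IsQuaternionAlgebra ℚ D] [Algebra ℚ D] [Ring D] in
/-- A set of integer pairs cut out by a predicate equal to a finset has that finset's cardinality. [folklore] -/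
theorem card_subtype_eq_of_iff {P : ℤ × ℤ → Prop} {F : Finset (ℤ × ℤ)} (h : ∀ uv, P uv ↔ uv ∈ F) :
    Nat.card {uv : ℤ × ℤ // P uv} = F.card := by
  have : {uv : ℤ × ℤ // P uv} = ↥(F : Set (ℤ × ℤ)) := by
    congr 1; ext uv; exact h uv
  rw [this, Nat.card_coe_set_eq, Set.ncard_coe_finset]

end Solutions

namespace PicHyp

variable {σ : D} {r₀ : ℚ} {m : ℕ} {t n : ℤ} (H : PicHyp γ B σ r₀ m t n)
include H

/-! ### Coordinates and norms on `B = [1, σ]` -/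

/-- Integer coordinates on `B` are unique. [folklore] -/
theorem coords_unique {u v u' v' : ℤ}
    (h : algebraMap ℚ D (u : ℚ) + v • σ = algebraMap ℚ D (u' : ℚ) + v' • σ) : u = u' ∧ v = v' := by
  haveI : Nontrivial D := nontrivial_of_isQuaternionAlgebra
  have e : (u - u') • (1 : D) + (v - v') • σ = 0 := by
    rw [sub_smul, sub_smul, zsmul_one, zsmul_one, ← map_intCast (algebraMap ℚ D) u,
      ← map_intCast (algebraMap ℚ D) u', ← sub_eq_zero.mpr h]
    abel
  obtain ⟨h1, h2⟩ := (zsmul_one_add_zsmul_eq_zero_iff H.σ_not_mem_bot).mp e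
  exact ⟨sub_eq_zero.mp h1, sub_eq_zero.mp h2⟩

/-- `nrd(u + vσ) = u² + tuv + nv²`. [cite: Cox2013, §7.A (norm form of an order)] -/
theorem reducedNorm_coords (u v : ℤ) :
    reducedNorm ℚ D (algebraMap ℚ D (u : ℚ) + v • σ) = ((u ^ 2 + t * u * v + n * v ^ 2 : ℤ) : ℚ) := by
  obtain ⟨ht, hn⟩ := trd_nrd_of_sq H.hγ H.hm H.hσ H.hsq
  rw [← Int.cast_smul_eq_zsmul ℚ, reducedNorm_ratCoords (γ := σ), ht, hn]
  push_cast; ring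

/-- `trd(u + vσ) = 2u + tv`. [folklore] -/
theorem reducedTrace_coords (u v : ℤ) :
    reducedTrace ℚ D (algebraMap ℚ D (u : ℚ) + v • σ) = ((2 * u + t * v : ℤ) : ℚ) := by
  obtain ⟨ht, -⟩ := trd_nrd_of_sq H.hγ H.hm H.hσ H.hsq
  rw [← Int.cast_smul_eq_zsmul ℚ, reducedTrace_ratCoords (γ := σ), ht]
  push_cast; ring

omit [IsQuaternionAlgebra ℚ D] in
/-- `u + vσ ∈ ℚ(γ)`. [folklore] -/
theorem coords_mem_adjoin (u v : ℤ) : algebraMap ℚ D (u : ℚ) + v • σ ∈ Algebra.adjoin ℚ {γ} :=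
  Subalgebra.add_mem _ (Subalgebra.algebraMap_mem _ _) (Subalgebra.zsmul_mem _ H.σ_mem_adjoin v)

/-- The conjugate of `u + vσ` is `(u + tv) - vσ`. [folklore] -/
theorem standardInvolution_coords (u v : ℤ) :
    standardInvolution ℚ D (algebraMap ℚ D (u : ℚ) + v • σ) = algebraMap ℚ D ((u + t * v : ℤ) : ℚ) + (-v) • σ := by
  rw [standardInvolution_def, H.reducedTrace_coords]
  have e : ((2 * u + t * v : ℤ) : ℚ) = (u : ℚ) + ((u + t * v : ℤ) : ℚ) := by push_cast; ring
  rw [e, map_add, neg_smul]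
  abel

/-- **The units of `B`**: `x ∈ B` has an inverse in `B` iff `x = u + vσ` with
`u² + tuv + nv² = 1`. [cite: Cox2013, §7.A (units of an order)] -/
theorem mem_units_iff (x : D) :
    (x ∈ B ∧ ∃ y ∈ B, x * y = 1 ∧ y * x = 1) ↔
      ∃ u v : ℤ, x = algebraMap ℚ D (u : ℚ) + v • σ ∧ u ^ 2 + t * u * v + n * v ^ 2 = 1 := by
  haveI : Nontrivial D := nontrivial_of_isQuaternionAlgebra
  constructor
  · rintro ⟨hx, y, hy, hxy, -⟩
    obtain ⟨u, v, rfl⟩ := (H.hBσ _).mp hx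
    obtain ⟨u', v', rfl⟩ := (H.hBσ _).mp hy
    refine ⟨u, v, rfl, ?_⟩
    have hmul := congrArg (reducedNorm ℚ D) hxy
    rw [reducedNorm_mul_holds ℚ D, reducedNorm_one, H.reducedNorm_coords, H.reducedNorm_coords, ← Int.cast_mul,
      show (1 : ℚ) = ((1 : ℤ) : ℚ) by simp, Int.cast_inj] at hmul
    have hx0 : algebraMap ℚ D (u : ℚ) + v • σ ≠ 0 := fun h => by
      rw [h, zero_mul] at hxy; exact zero_ne_one hxy
    have hpos := reducedNorm_pos_of_mem_adjoin H.hdiv H.hγ H.himag (H.coords_mem_adjoin u v) hx0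
    rw [H.reducedNorm_coords] at hpos
    have hposZ : 0 < u ^ 2 + t * u * v + n * v ^ 2 := by exact_mod_cast hpos
    exact Int.eq_one_of_mul_eq_one_right hposZ.le hmul
  · rintro ⟨u, v, rfl, hN⟩
    have hx : algebraMap ℚ D (u : ℚ) + v • σ ∈ B := (H.hBσ _).mpr ⟨u, v, rfl⟩
    have hnrd : reducedNorm ℚ D (algebraMap ℚ D (u : ℚ) + v • σ) = 1 := by
      rw [H.reducedNorm_coords, hN]; simp
    have hxy : (algebraMap ℚ D (u : ℚ) + v • σ) * standardInvolution ℚ D (algebraMap ℚ D (u : ℚ) + v • σ) = 1 := by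
      rw [mul_standardInvolution_holds ℚ D, hnrd, map_one]
    have hyx : standardInvolution ℚ D (algebraMap ℚ D (u : ℚ) + v • σ) * (algebraMap ℚ D (u : ℚ) + v • σ) = 1 := by
      rw [← hxy, standardInvolution_def, sub_mul, mul_sub, Algebra.commutes]
    refine ⟨hx, _, ?_, hxy, hyx⟩
    rw [H.standardInvolution_coords]
    exact (H.hBσ _).mpr ⟨u + t * v, -v, rfl⟩

/-- **The units of `B` correspond to the solutions of `u² + tuv + nv² = 1`.** [cite: Cox2013, §7.A (units of an order)] -/
theorem card_units_eq_card_solutions :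
    Nat.card {x : D // x ∈ B ∧ ∃ y ∈ B, x * y = 1 ∧ y * x = 1} =
      Nat.card {uv : ℤ × ℤ // uv.1 ^ 2 + t * uv.1 * uv.2 + n * uv.2 ^ 2 = 1} := by
  classical
  -- coordinates of a unit
  have hex : ∀ x : {x : D // x ∈ B ∧ ∃ y ∈ B, x * y = 1 ∧ y * x = 1},
      ∃ uv : ℤ × ℤ, (x : D) = algebraMap ℚ D (uv.1 : ℚ) + uv.2 • σ ∧ uv.1 ^ 2 + t * uv.1 * uv.2 + n * uv.2 ^ 2 = 1 :=
    fun x => by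
      obtain ⟨u, v, h1, h2⟩ := (H.mem_units_iff x).mp x.2
      exact ⟨(u, v), h1, h2⟩
  refine Nat.card_congr
    { toFun := fun x => ⟨(hex x).choose, (hex x).choose_spec.2⟩
      invFun := fun uv => ⟨algebraMap ℚ D (uv.1.1 : ℚ) + uv.1.2 • σ, (H.mem_units_iff _).mpr ⟨_, _, rfl, uv.2⟩⟩
      left_inv := fun x => Subtype.ext (hex x).choose_spec.1.symm
      right_inv := fun uv => ?_ }
  apply Subtype.ext
  set x : {x : D // x ∈ B ∧ ∃ y ∈ B, x * y = 1 ∧ y * x = 1} :=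
    ⟨algebraMap ℚ D (uv.1.1 : ℚ) + uv.1.2 • σ, (H.mem_units_iff _).mpr ⟨_, _, rfl, uv.2⟩⟩ with hx
  have h := (hex x).choose_spec.1
  change algebraMap ℚ D (uv.1.1 : ℚ) + uv.1.2 • σ = _ at h
  obtain ⟨h1, h2⟩ := H.coords_unique h
  exact Prod.ext h1.symm h2.symm

/-- **`#Bˣ = 6, 4, 2`** according as `disc(B) = t² - 4n` is `-3`, `-4`, or `< -4`
(`B = ℤ[ω], ℤ[i]`, or any other imaginary quadratic order). [cite: Cox2013, §7.A (units of imaginary quadratic orders; proof of Thm. 7.24)] -/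
theorem card_units_eq :
    Nat.card {x : D // x ∈ B ∧ ∃ y ∈ B, x * y = 1 ∧ y * x = 1} =
      if t ^ 2 - 4 * n = -3 then 6 else if t ^ 2 - 4 * n = -4 then 4 else 2 := by
  rw [H.card_units_eq_card_solutions]
  have hneg := H.disc_neg
  -- `t² - 4n ≡ 0, 1 (mod 4)`
  rcases Int.even_or_odd t with ⟨k, hk⟩ | ⟨k, hk⟩
  · have hk' : t = 2 * k := by rw [hk]; ring
    have hdvd : 4 ∣ t ^ 2 - 4 * n := ⟨k ^ 2 - n, by rw [hk']; ring⟩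
    by_cases h4 : t ^ 2 - 4 * n = -4
    · rw [if_neg (by omega), if_pos h4, card_subtype_eq_of_iff (fun uv => solutions_of_eq_neg_four hk' h4)]
      rw [Finset.card_insert_of_notMem (by simp), Finset.card_insert_of_notMem (by simp),
        Finset.card_insert_of_notMem (by simp), Finset.card_singleton]
    · have hlt : t ^ 2 - 4 * n < -4 := by omega
      rw [if_neg (by omega), if_neg h4, card_subtype_eq_of_iff (fun uv => solutions_of_lt hlt)]
      rw [Finset.card_insert_of_notMem (by simp), Finset.card_singleton]
  · have hk' : t = 2 * k + 1 := hk
    have hdvd : 4 ∣ t ^ 2 - 4 * n - 1 := ⟨k ^ 2 + k - n, by rw [hk']; ring⟩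
    by_cases h3 : t ^ 2 - 4 * n = -3
    · rw [if_pos h3, card_subtype_eq_of_iff (fun uv => solutions_of_eq_neg_three hk' h3)]
      rw [Finset.card_insert_of_notMem (by simp), Finset.card_insert_of_notMem (by simp),
        Finset.card_insert_of_notMem (by simp; omega), Finset.card_insert_of_notMem (by simp),
        Finset.card_insert_of_notMem (by simp), Finset.card_singleton]
    · have hlt : t ^ 2 - 4 * n < -4 := by omega
      rw [if_neg h3, if_neg (by omega), card_subtype_eq_of_iff (fun uv => solutions_of_lt hlt)]
      rw [Finset.card_insert_of_notMem (by simp), Finset.card_singleton]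

end PicHyp

end Brandt

end Literature.NumberTheory.Automorphic

end
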